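import Mathlib.NumberTheory.Padics.RingHoms
import Mathlib.NumberTheory.Padics.PadicVal.Basic
import Literature.NumberTheory.EllipticCurves.Curve15A1Descent
import HarnessLib

/-!
# Two-adic tools for Monsky's descent lemmas (Monsky 1990, Lemma 5.4 and Lemma 4.10 / 5.8)

Monsky, *Mock Heegner points and congruent numbers*, Math. Z. 204 (1990) 45–67, proves his
`2`-indivisibility theorems (Thm 5.5, Thm 5.9 (1)) through two descent lemmas, Lemma 5.4 (p. 62) and
Lemma 5.8 (p. 63, "identical with that of Lemma 4.10", p. 59), whose arithmetic content is a statement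
about rational numbers `u` with `u(u + 1)(u − 1) = −N v²`:

* "`u`, `u + 1`, `u − 1` are in the subgroup of `ℚ*` generated by `−1, 2, p, q` and the squares"
  (valuations away from `2, p, q` are even — the classical first step of a `2`-descent);
* "the quadratic form `r² + p₅s²` would have to represent `2` rationally" (impossible for `p ≡ 5 (8)`);
* "`u` is `2`-integral, and a congruence argument modulo a power of `2` gives a contradiction".

This file provides the three tools in the form the Lean transplant of those lemmas (sibling files
`Monsky1990/DescentLemma*.lean`) consumes:

* `exists_abs_eq_two_pow_mul_pow_mul_pow_mul_sq`: `|r| = 2^a p^b q^c w²` with `a, b, c ∈ {0, 1}`, from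
  even valuations away from `{2, p, q}` (on top of the tree's `Curve15A1.exists_abs_eq_sq_or₂`);
* `even_padicValRat_of_cubic`: the even valuations, from `u(u + 1)(u − 1) = −N v²` at a prime `ℓ ∤ 2N`
  (the tree's `Curve24A1.even_padicValRat_sub` applied to `Y² = X(X − N)(X + N)`, `X = −Nu`);
* `eq_zero_of_sq_add_mul_sq_eq_two_mul_sq`: `x² + p y² = 2 z²` has only the trivial rational solution
  when `p ≡ 5 (mod 8)` (Fermat descent modulo `8`);
* `red`: reduction of a `2`-integral rational modulo `2ⁿ` through `ℤ_[2] → ZMod (2ⁿ)`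
  (`PadicInt.toZModPow`), with the ring-homomorphism identities needed to transport the congruence
  arguments to `ZMod 16` where they are decided by `decide`.

Nothing here is specific to elliptic curves; the file is placed with the Monsky transplant because
that is its only consumer. All results are fully proved (no named facts).

## References

* P. Monsky, Mock Heegner points and congruent numbers, Math. Z. 204 (1990) 45–67, pp. 59, 62–63.
  [Monsky1990MockHeegner]
* J. H. Silverman, *The Arithmetic of Elliptic Curves*, 2nd ed., Prop. X.1.4, Example X.1.5.
  [SilvermanAEC2009]
-/

noncomputable section

namespace Literature.NumberTheory.EllipticCurves.Monsky1990

/-! ### `2`-integral rationals and their reduction modulo `2ⁿ` -/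

/-- A rational number with odd denominator, viewed in `ℤ_[2]` (its `2`-adic norm is `≤ 1`,
`padicNormE.norm_rat_le_one`). [folklore] -/
def toPadicInt (q : ℚ) (h : ¬ 2 ∣ q.den) : ℤ_[2] :=
  ⟨(q : ℚ_[2]), Padic.norm_rat_le_one h⟩

/-- The underlying `2`-adic number of `toPadicInt q h` is `q`. [cite: Monsky1990MockHeegner, Lemma 5.4 (p. 62), the congruence argument modulo a power of 2] -/
@[simp] theorem coe_toPadicInt (q : ℚ) (h : ¬ 2 ∣ q.den) :
    ((toPadicInt q h : ℤ_[2]) : ℚ_[2]) = (q : ℚ_[2]) := rfl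

/-- **Reduction of a `2`-integral rational modulo `2ⁿ`**: `q ↦ (q mod 2ⁿ) ∈ ZMod (2ⁿ)` through
`ℤ_[2] → ℤ/2ⁿ` (Mathlib's `PadicInt.toZModPow`). This is the map "`u` is `2`-integral, and a
congruence argument modulo a power of `2`" of Monsky's Lemma 5.4 refers to.
[cite: Monsky1990MockHeegner, Lemma 5.4 (p. 62)] -/
def red (n : ℕ) (q : ℚ) (h : ¬ 2 ∣ q.den) : ZMod (2 ^ n) :=
  PadicInt.toZModPow n (toPadicInt q h)

/-- `red` is additive. [cite: Monsky1990MockHeegner, Lemma 5.4 (p. 62), the congruence argument modulo a power of 2] -/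
theorem red_add (n : ℕ) {a b : ℚ} (ha : ¬ 2 ∣ a.den) (hb : ¬ 2 ∣ b.den) (hab : ¬ 2 ∣ (a + b).den) :
    red n (a + b) hab = red n a ha + red n b hb := by
  have : toPadicInt (a + b) hab = toPadicInt a ha + toPadicInt b hb :=
    Subtype.ext (by simp [toPadicInt])
  unfold red
  rw [this, map_add]

/-- `red` is multiplicative. [cite: Monsky1990MockHeegner, Lemma 5.4 (p. 62), the congruence argument modulo a power of 2] -/
theorem red_mul (n : ℕ) {a b : ℚ} (ha : ¬ 2 ∣ a.den) (hb : ¬ 2 ∣ b.den) (hab : ¬ 2 ∣ (a * b).den) :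
    red n (a * b) hab = red n a ha * red n b hb := by
  have : toPadicInt (a * b) hab = toPadicInt a ha * toPadicInt b hb :=
    Subtype.ext (by simp [toPadicInt])
  unfold red
  rw [this, map_mul]

/-- `red` respects subtraction. [cite: Monsky1990MockHeegner, Lemma 5.4 (p. 62), the congruence argument modulo a power of 2] -/
theorem red_sub (n : ℕ) {a b : ℚ} (ha : ¬ 2 ∣ a.den) (hb : ¬ 2 ∣ b.den) (hab : ¬ 2 ∣ (a - b).den) :
    red n (a - b) hab = red n a ha - red n b hb := by
  have : toPadicInt (a - b) hab = toPadicInt a ha - toPadicInt b hb :=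
    Subtype.ext (by simp [toPadicInt])
  unfold red
  rw [this, map_sub]

/-- `red` of a square is the square of `red`. [cite: Monsky1990MockHeegner, Lemma 5.4 (p. 62), the congruence argument modulo a power of 2] -/
theorem red_sq (n : ℕ) {a : ℚ} (ha : ¬ 2 ∣ a.den) (haa : ¬ 2 ∣ (a ^ 2).den) :
    red n (a ^ 2) haa = red n a ha ^ 2 := by
  have : toPadicInt (a ^ 2) haa = toPadicInt a ha ^ 2 :=
    Subtype.ext (by simp [toPadicInt])
  unfold red
  rw [this, map_pow]

/-- `red` of an integer is the integer modulo `2ⁿ`. [cite: Monsky1990MockHeegner, Lemma 5.4 (p. 62), the congruence argument modulo a power of 2] -/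
theorem red_intCast (n : ℕ) (m : ℤ) (h : ¬ 2 ∣ ((m : ℚ)).den) :
    red n (m : ℚ) h = (m : ZMod (2 ^ n)) := by
  have : toPadicInt (m : ℚ) h = (m : ℤ_[2]) := Subtype.ext (by simp [toPadicInt])
  unfold red
  rw [this, map_intCast]

/-- `red` only depends on the rational number (proof irrelevance of the `2`-integrality witness).
[cite: Monsky1990MockHeegner, Lemma 5.4 (p. 62), the congruence argument modulo a power of 2] -/
theorem red_congr (n : ℕ) {a b : ℚ} (ha : ¬ 2 ∣ a.den) (hb : ¬ 2 ∣ b.den) (h : a = b) :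
    red n a ha = red n b hb := by
  subst h
  rfl

/-- `red` of a natural number is that number modulo `2ⁿ`. [cite: Monsky1990MockHeegner, Lemma 5.4 (p. 62), the congruence argument modulo a power of 2] -/
theorem red_natCast (n : ℕ) (m : ℕ) (h : ¬ 2 ∣ ((m : ℚ)).den) :
    red n (m : ℚ) h = (m : ZMod (2 ^ n)) := by
  have := red_intCast n m (by simp)
  simpa using this

/-- `red` of `1`. [cite: Monsky1990MockHeegner, Lemma 5.4 (p. 62), the congruence argument modulo a power of 2] -/
theorem red_one (n : ℕ) (h : ¬ 2 ∣ ((1 : ℚ)).den) : red n 1 h = 1 := by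
  simpa using red_natCast n 1 (by simp)

/-- Integers have odd denominator. [cite: Monsky1990MockHeegner, Lemma 5.4 (p. 62), the congruence argument modulo a power of 2] -/
theorem not_two_dvd_den_intCast (m : ℤ) : ¬ 2 ∣ ((m : ℚ)).den := by
  simp

/-- Natural numbers have odd denominator. [cite: Monsky1990MockHeegner, Lemma 5.4 (p. 62), the congruence argument modulo a power of 2] -/
theorem not_two_dvd_den_natCast (m : ℕ) : ¬ 2 ∣ ((m : ℚ)).den := by
  simp

/-- **A rational with non-negative `2`-adic valuation has odd denominator** (`num` and `den` are
coprime, so `2 ∣ den` would force `ord₂ = −ord₂(den) < 0`). [cite: Monsky1990MockHeegner, Lemma 5.4 (p. 62), the congruence argument modulo a power of 2] -/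
theorem not_two_dvd_den_of_padicValRat_nonneg {q : ℚ} (h : 0 ≤ padicValRat 2 q) : ¬ 2 ∣ q.den := by
  intro h2
  have hnum : ¬ (2 : ℤ) ∣ q.num := by
    intro hn
    have h1 : 2 ∣ q.num.natAbs := Int.natCast_dvd.mp hn
    have := Nat.eq_one_of_dvd_coprimes q.reduced h1 h2
    omega
  have hv : padicValRat 2 q = padicValInt 2 q.num - padicValNat 2 q.den := rfl
  rw [padicValInt.eq_zero_of_not_dvd hnum] at hv
  have hd : 1 ≤ padicValNat 2 q.den := one_le_padicValNat_of_dvd q.pos.ne' h2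
  omega

/-- **A `2`-integral rational with positive `2`-adic valuation reduces to an even residue**
(`q = 2 q'` with `q'` `2`-integral). [cite: Monsky1990MockHeegner, Lemma 5.4 (p. 62), the congruence argument modulo a power of 2] -/
theorem exists_red_eq_two_mul {n : ℕ} {q : ℚ} (hq : ¬ 2 ∣ q.den) (h : 0 < padicValRat 2 q) :
    ∃ r : ZMod (2 ^ n), red n q hq = 2 * r := by
  have hq0 : q ≠ 0 := by
    rintro rfl
    simp at h
  have h2 : (2 : ℚ) ≠ 0 := two_ne_zero
  have hv : 0 ≤ padicValRat 2 (q / 2) := by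
    rw [padicValRat.div hq0 h2, show (2 : ℚ) = ((2 : ℕ) : ℚ) by norm_num, padicValRat.of_nat,
      padicValNat_self]
    omega
  have hq' := not_two_dvd_den_of_padicValRat_nonneg hv
  refine ⟨red n (q / 2) hq', ?_⟩
  have hmul : q = ((2 : ℕ) : ℚ) * (q / 2) := by push_cast; field_simp
  rw [red_congr n hq (by rw [← hmul]; exact hq) hmul, red_mul n (not_two_dvd_den_natCast 2) hq',
    red_natCast]
  norm_num

/-- **A rational with odd denominator has non-negative `2`-adic valuation.** [cite: Monsky1990MockHeegner, Lemma 5.4 (p. 62), the congruence argument modulo a power of 2] -/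
theorem padicValRat_nonneg_of_not_two_dvd_den {q : ℚ} (h : ¬ 2 ∣ q.den) : 0 ≤ padicValRat 2 q := by
  have hv : padicValRat 2 q = padicValInt 2 q.num - padicValNat 2 q.den := rfl
  rw [padicValNat.eq_zero_of_not_dvd h] at hv
  omega

/-- The denominator of a product of `2`-integral rationals is odd (`Rat.mul_den_dvd`). [cite: Monsky1990MockHeegner, Lemma 5.4 (p. 62), the congruence argument modulo a power of 2] -/
theorem not_two_dvd_den_mul {a b : ℚ} (ha : ¬ 2 ∣ a.den) (hb : ¬ 2 ∣ b.den) : ¬ 2 ∣ (a * b).den := by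
  intro h
  have := dvd_trans h (Rat.mul_den_dvd a b)
  rcases (Nat.prime_two.dvd_mul).mp this with h' | h'
  · exact ha h'
  · exact hb h'

/-- The denominator of a sum of `2`-integral rationals is odd (`Rat.add_den_dvd`). [cite: Monsky1990MockHeegner, Lemma 5.4 (p. 62), the congruence argument modulo a power of 2] -/
theorem not_two_dvd_den_add {a b : ℚ} (ha : ¬ 2 ∣ a.den) (hb : ¬ 2 ∣ b.den) : ¬ 2 ∣ (a + b).den := by
  intro h
  have := dvd_trans h (Rat.add_den_dvd a b)
  rcases (Nat.prime_two.dvd_mul).mp this with h' | h'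
  · exact ha h'
  · exact hb h'

/-- The denominator of a difference of `2`-integral rationals is odd. [cite: Monsky1990MockHeegner, Lemma 5.4 (p. 62), the congruence argument modulo a power of 2] -/
theorem not_two_dvd_den_sub {a b : ℚ} (ha : ¬ 2 ∣ a.den) (hb : ¬ 2 ∣ b.den) : ¬ 2 ∣ (a - b).den := by
  rw [sub_eq_add_neg]
  exact not_two_dvd_den_add ha (by rwa [Rat.neg_den])

/-- The denominator of the square of a `2`-integral rational is odd. [cite: Monsky1990MockHeegner, Lemma 5.4 (p. 62), the congruence argument modulo a power of 2] -/
theorem not_two_dvd_den_sq {a : ℚ} (ha : ¬ 2 ∣ a.den) : ¬ 2 ∣ (a ^ 2).den := by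
  rw [sq]
  exact not_two_dvd_den_mul ha ha

/-- `2^a · c` (`a, c ∈ ℕ`) has odd denominator. [cite: Monsky1990MockHeegner, Lemma 5.4 (p. 62), the congruence argument modulo a power of 2] -/
theorem not_two_dvd_den_two_pow_mul_natCast (a c : ℕ) : ¬ 2 ∣ ((2 : ℚ) ^ a * c).den := by
  rw [show (2 : ℚ) ^ a * c = ((2 ^ a * c : ℕ) : ℚ) by push_cast; ring]
  exact not_two_dvd_den_natCast _

/-- `red (2^a · c) = 2^a · c`. [cite: Monsky1990MockHeegner, Lemma 5.4 (p. 62), the congruence argument modulo a power of 2] -/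
theorem red_two_pow_mul_natCast (n a c : ℕ) :
    red n ((2 : ℚ) ^ a * c) (not_two_dvd_den_two_pow_mul_natCast a c) =
      2 ^ a * (c : ZMod (2 ^ n)) := by
  rw [red_congr n _ (not_two_dvd_den_natCast (2 ^ a * c)) (by push_cast; ring), red_natCast]
  push_cast
  ring

/-- **Reduction of a square-class relation**: if `u = 2^a · c · r²` with `u`, `r` `2`-integral, then
`red u = 2^a · c · (red r)²`. [cite: Monsky1990MockHeegner, Lemma 5.4 (p. 62), the congruence argument modulo a power of 2] -/
theorem red_of_eq_two_pow_mul_natCast_mul_sq (n a c : ℕ) {u r : ℚ} (hu : ¬ 2 ∣ u.den)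
    (hr : ¬ 2 ∣ r.den) (h : u = 2 ^ a * c * r ^ 2) :
    red n u hu = 2 ^ a * (c : ZMod (2 ^ n)) * red n r hr ^ 2 := by
  have hden : ¬ 2 ∣ ((2 : ℚ) ^ a * c * r ^ 2).den := by rw [← h]; exact hu
  rw [red_congr n hu hden h,
    red_mul n (not_two_dvd_den_two_pow_mul_natCast a c) (not_two_dvd_den_sq hr),
    red_two_pow_mul_natCast, red_sq n hr]

/-! ### Fermat descent: `x² + p y² = 2 z²` for `p ≡ 5 (mod 8)` -/

/-- **Modulo `8`, `x² + 5y² = 2z²` forces `x`, `y` even** (a finite check; `5 ≡ p (mod 8)`).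
[cite: Monsky1990MockHeegner, Lemma 5.4 (p. 62), the form r² + p₅s² does not represent 2] -/
theorem zmod_eight_check (x y z : ZMod 8) (h : x ^ 2 + 5 * y ^ 2 = 2 * z ^ 2) :
    4 * x = 0 ∧ 4 * y = 0 := by
  revert x y z
  decide

/-- **Integer descent**: for `p ≡ 5 (mod 8)` the only integer solution of `x² + p y² = 2 z²` is
`x = y = z = 0` — modulo `8`, `x` and `y` are even, then `z` is even, and `(x/2, y/2, z/2)` is a
smaller solution (Monsky: "the quadratic form `r² + p₅ s²` would have to represent `2` rationally",
impossible since `2` is a non-residue modulo `p₅`). [cite: Monsky1990MockHeegner, Lemma 5.4 (p. 62)] -/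
theorem eq_zero_of_sq_add_mul_sq_eq_two_mul_sq_int {p : ℕ} (hp : p % 8 = 5) {x y z : ℤ}
    (h : x ^ 2 + p * y ^ 2 = 2 * z ^ 2) : x = 0 ∧ y = 0 ∧ z = 0 := by
  suffices key : ∀ (n : ℕ) (x y z : ℤ), x.natAbs + y.natAbs + z.natAbs ≤ n →
      x ^ 2 + p * y ^ 2 = 2 * z ^ 2 → x = 0 ∧ y = 0 ∧ z = 0 from
    key _ x y z le_rfl h
  intro n
  induction n with
  | zero =>
    intro x y z hn _
    omega
  | succ n ih =>
    intro x y z hn h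
    -- reduce modulo `8`
    have h8 : (x : ZMod 8) ^ 2 + 5 * (y : ZMod 8) ^ 2 = 2 * (z : ZMod 8) ^ 2 := by
      have hp8 : ((p : ℕ) : ZMod 8) = 5 := by
        rw [← ZMod.natCast_mod, hp]
        rfl
      have := congrArg (Int.cast : ℤ → ZMod 8) h
      push_cast at this
      rw [hp8] at this
      exact this
    obtain ⟨hx, hy⟩ := zmod_eight_check _ _ _ h8
    have hx2 : (2 : ℤ) ∣ x := by
      have : ((4 * x : ℤ) : ZMod 8) = 0 := by push_cast; exact hx
      obtain ⟨c, hc⟩ := (ZMod.intCast_zmod_eq_zero_iff_dvd _ 8).mp this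
      exact ⟨c, by omega⟩
    have hy2 : (2 : ℤ) ∣ y := by
      have : ((4 * y : ℤ) : ZMod 8) = 0 := by push_cast; exact hy
      obtain ⟨c, hc⟩ := (ZMod.intCast_zmod_eq_zero_iff_dvd _ 8).mp this
      exact ⟨c, by omega⟩
    obtain ⟨x', rfl⟩ := hx2
    obtain ⟨y', rfl⟩ := hy2
    have hz : z ^ 2 = 2 * (x' ^ 2 + p * y' ^ 2) := by
      have h2 : (2 : ℤ) * z ^ 2 = 2 * (2 * (x' ^ 2 + p * y' ^ 2)) := by linear_combination -h
      exact mul_left_cancel₀ two_ne_zero h2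
    have hz2 : (2 : ℤ) ∣ z := by
      have : (2 : ℤ) ∣ z ^ 2 := ⟨_, hz⟩
      exact Int.prime_two.dvd_of_dvd_pow this
    obtain ⟨z', rfl⟩ := hz2
    have h' : x' ^ 2 + p * y' ^ 2 = 2 * z' ^ 2 := by
      have h2 : (2 : ℤ) * (x' ^ 2 + p * y' ^ 2) = 2 * (2 * z' ^ 2) := by linear_combination hz.symm
      exact mul_left_cancel₀ two_ne_zero h2
    by_cases h0 : x' = 0 ∧ y' = 0 ∧ z' = 0
    · obtain ⟨rfl, rfl, rfl⟩ := h0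
      simp
    · simp only [Int.natAbs_mul] at hn
      have h2abs : (2 : ℤ).natAbs = 2 := rfl
      rw [h2abs] at hn
      exact absurd (ih x' y' z' (by omega) h') h0

/-- **Rational descent**: for `p ≡ 5 (mod 8)`, `x² + p y² = 2 z²` has no rational solution other than
`x = y = z = 0` (clear denominators). [cite: Monsky1990MockHeegner, Lemma 5.4 (p. 62)] -/
theorem eq_zero_of_sq_add_mul_sq_eq_two_mul_sq {p : ℕ} (hp : p % 8 = 5) {x y z : ℚ}
    (h : x ^ 2 + p * y ^ 2 = 2 * z ^ 2) : x = 0 ∧ y = 0 ∧ z = 0 := by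
  set D : ℚ := (x.den : ℚ) * y.den * z.den with hD
  have hD0 : D ≠ 0 := by rw [hD]; positivity
  have hx : x * D = ((x.num * y.den * z.den : ℤ) : ℚ) := by
    push_cast; rw [hD, ← Rat.mul_den_eq_num x]; ring
  have hy : y * D = ((y.num * x.den * z.den : ℤ) : ℚ) := by
    push_cast; rw [hD, ← Rat.mul_den_eq_num y]; ring
  have hz : z * D = ((z.num * x.den * y.den : ℤ) : ℚ) := by
    push_cast; rw [hD, ← Rat.mul_den_eq_num z]; ring
  have key : (x * D) ^ 2 + p * (y * D) ^ 2 = 2 * (z * D) ^ 2 := by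
    linear_combination D ^ 2 * h
  rw [hx, hy, hz] at key
  have key' : (x.num * y.den * z.den) ^ 2 + p * (y.num * x.den * z.den) ^ 2 =
      2 * (z.num * x.den * y.den) ^ 2 := by
    exact_mod_cast key
  obtain ⟨h1, h2, h3⟩ := eq_zero_of_sq_add_mul_sq_eq_two_mul_sq_int hp key'
  refine ⟨?_, ?_, ?_⟩
  · have : x * D = 0 := by rw [hx, h1, Int.cast_zero]
    exact (mul_eq_zero.mp this).resolve_right hD0
  · have : y * D = 0 := by rw [hy, h2, Int.cast_zero]
    exact (mul_eq_zero.mp this).resolve_right hD0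
  · have : z * D = 0 := by rw [hz, h3, Int.cast_zero]
    exact (mul_eq_zero.mp this).resolve_right hD0

/-! ### Square classes away from `{2, p, q}` and the valuations of `u(u + 1)(u − 1) = −N v²` -/

/-- **From even valuations away from `{2, p, q}` to a square class in `⟨2, p, q⟩`**: if `r ≠ 0` and
`ord_ℓ(r)` is even for every prime `ℓ ∉ {2, p, q}`, then `|r| = 2^a p^b q^c w²` with
`a, b, c ∈ {0, 1}` ("`u` … in the subgroup of `ℚ*` generated by `−1, 2, p₃, p₅` and the squares",
Monsky p. 62; Silverman AEC Example X.1.5). Built on the tree's `Curve15A1.exists_abs_eq_sq_or₂`.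
[cite: Monsky1990MockHeegner, Lemma 5.4 (p. 62)] -/
theorem exists_abs_eq_two_pow_mul_pow_mul_pow_mul_sq {r : ℚ} (hr : r ≠ 0) (p q : ℕ) (hp : p.Prime)
    (hq : q.Prime) (h : ∀ ℓ : ℕ, ℓ.Prime → ℓ ≠ 2 → ℓ ≠ p → ℓ ≠ q → Even (padicValRat ℓ r)) :
    ∃ w : ℚ, ∃ a b c : ℕ, a ≤ 1 ∧ b ≤ 1 ∧ c ≤ 1 ∧
      |r| = 2 ^ a * (p : ℚ) ^ b * (q : ℚ) ^ c * w ^ 2 := by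
  haveI := Fact.mk hp
  haveI := Fact.mk hq
  have h2 : (2 : ℚ) ≠ 0 := two_ne_zero
  by_cases hev : Even (padicValRat 2 r)
  · obtain ⟨w, hw⟩ := Curve15A1.exists_abs_eq_sq_or₂ hr p q fun ℓ hℓ hℓp hℓq => by
      by_cases hℓ2 : ℓ = 2
      · subst hℓ2; exact hev
      · exact h ℓ hℓ hℓ2 hℓp hℓq
    rcases hw with hw | hw | hw | hw
    · exact ⟨w, 0, 0, 0, by norm_num, by norm_num, by norm_num, by rw [hw]; ring⟩
    · exact ⟨w, 0, 1, 0, by norm_num, by norm_num, by norm_num, by rw [hw]; ring⟩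
    · exact ⟨w, 0, 0, 1, by norm_num, by norm_num, by norm_num, by rw [hw]; ring⟩
    · exact ⟨w, 0, 1, 1, by norm_num, by norm_num, by norm_num, by rw [hw]; ring⟩
  · have hr2 : r / 2 ≠ 0 := div_ne_zero hr h2
    obtain ⟨w, hw⟩ := Curve15A1.exists_abs_eq_sq_or₂ hr2 p q fun ℓ hℓ hℓp hℓq => by
      haveI := Fact.mk hℓ
      rw [padicValRat.div hr h2, show (2 : ℚ) = ((2 : ℕ) : ℚ) by norm_num, padicValRat.of_nat]
      by_cases hℓ2 : ℓ = 2
      · subst hℓ2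
        rw [padicValNat_self, Nat.cast_one]
        rw [Int.not_even_iff_odd] at hev
        obtain ⟨k, hk⟩ := hev
        exact ⟨k, by omega⟩
      · rw [padicValNat_primes hℓ2, Nat.cast_zero, sub_zero]
        exact h ℓ hℓ hℓ2 hℓp hℓq
    have habs : |r| = 2 * |r / 2| := by
      rw [abs_div, abs_two, mul_div_cancel₀ _ h2]
    rcases hw with hw | hw | hw | hw
    · exact ⟨w, 1, 0, 0, by norm_num, by norm_num, by norm_num, by rw [habs, hw]; ring⟩
    · exact ⟨w, 1, 1, 0, by norm_num, by norm_num, by norm_num, by rw [habs, hw]; ring⟩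
    · exact ⟨w, 1, 0, 1, by norm_num, by norm_num, by norm_num, by rw [habs, hw]; ring⟩
    · exact ⟨w, 1, 1, 1, by norm_num, by norm_num, by norm_num, by rw [habs, hw]; ring⟩

/-- **Even valuations from the cubic relation**: if `u(u + 1)(u − 1) = −N v²` with `v ≠ 0` and
`ℓ ∤ 2N` is prime, then `ord_ℓ(u)`, `ord_ℓ(u + 1)`, `ord_ℓ(u − 1)` are all even — the tree's
`Curve24A1.even_padicValRat_sub` applied to `Y² = X(X − N)(X + N)` with `X = −Nu`, `Y = N²v`
("it follows that each of `u`, `u + 1` and `u − 1` is in the subgroup of `ℚ*` generated by `−1, 2, p₇`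
and the squares", Monsky p. 59). [cite: Monsky1990MockHeegner, Lemma 4.10 (p. 59), Lemma 5.4 (p. 62)] -/
theorem even_padicValRat_of_cubic (ℓ : ℕ) [hℓ : Fact ℓ.Prime] {N : ℕ} (hN : N ≠ 0)
    (hℓN : ¬ ℓ ∣ 2 * N) {u v : ℚ} (hv : v ≠ 0) (h : u * (u + 1) * (u - 1) = -(N : ℚ) * v ^ 2) :
    Even (padicValRat ℓ u) ∧ Even (padicValRat ℓ (u + 1)) ∧ Even (padicValRat ℓ (u - 1)) := by
  have hNQ : (N : ℚ) ≠ 0 := Nat.cast_ne_zero.mpr hN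
  have hℓN' : ¬ ℓ ∣ N := fun hd => hℓN (dvd_mul_of_dvd_right hd 2)
  have hvN : padicValRat ℓ (N : ℚ) = 0 := by
    rw [padicValRat.of_nat, padicValNat.eq_zero_of_not_dvd hℓN', Nat.cast_zero]
  have hv2N : padicValRat ℓ (2 * N : ℚ) = 0 := by
    rw [show (2 * N : ℚ) = ((2 * N : ℕ) : ℚ) by push_cast; ring, padicValRat.of_nat,
      padicValNat.eq_zero_of_not_dvd hℓN, Nat.cast_zero]
  -- the rescaled equation `Y² = X(X − N)(X + N)`
  set X : ℚ := -(N : ℚ) * u with hX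
  set Y : ℚ := (N : ℚ) ^ 2 * v with hY
  have hY0 : Y ≠ 0 := mul_ne_zero (pow_ne_zero 2 hNQ) hv
  have hXY : Y ^ 2 = (X - 0) * (X - N) * (X - (-N)) := by
    rw [hX, hY]
    linear_combination (N : ℚ) ^ 3 * h
  have hu : u = -(X / N) := by rw [hX]; field_simp
  have hu1 : u + 1 = -((X - N) / N) := by rw [hX]; field_simp; ring
  have hu2 : u - 1 = -((X - (-N)) / N) := by rw [hX]; field_simp; ring
  -- nonvanishing of the three factors
  have h0 : (X - 0) * (X - N) * (X - (-N)) ≠ 0 := hXY ▸ pow_ne_zero 2 hY0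
  have hx₁ : X - 0 ≠ 0 := fun h0' => h0 (by rw [h0', zero_mul, zero_mul])
  have hx₂ : X - N ≠ 0 := fun h0' => h0 (by rw [h0', mul_zero, zero_mul])
  have hx₃ : X - (-N) ≠ 0 := fun h0' => h0 (by rw [h0', mul_zero])
  have key : ∀ {e : ℚ}, Even (padicValRat ℓ (X - e)) → X - e ≠ 0 →
      Even (padicValRat ℓ (-((X - e) / N))) := by
    intro e he hne
    rw [padicValRat.neg, padicValRat.div hne hNQ, hvN, sub_zero]
    exact he
  have h01 : (0 : ℚ) ≠ N := fun h' => hNQ h'.symm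
  have h02 : (0 : ℚ) ≠ -N := fun h' => hNQ (neg_eq_zero.mp h'.symm)
  have hN0' : (N : ℚ) ≠ 0 := hNQ
  have hNn : (N : ℚ) ≠ -N := fun h' => hNQ (by linarith)
  have hnN : (-(N : ℚ)) ≠ 0 := neg_ne_zero.mpr hNQ
  have hnNN : (-(N : ℚ)) ≠ N := fun h' => hNQ (by linarith)
  have hv01 : padicValRat ℓ ((0 : ℚ) - N) = 0 := by rw [zero_sub, padicValRat.neg, hvN]
  have hv02 : padicValRat ℓ ((0 : ℚ) - (-N)) = 0 := by rw [zero_sub, neg_neg, hvN]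
  have hv10 : padicValRat ℓ ((N : ℚ) - 0) = 0 := by rw [sub_zero, hvN]
  have hv12 : padicValRat ℓ ((N : ℚ) - (-N)) = 0 := by rw [sub_neg_eq_add, ← two_mul, hv2N]
  have hv20 : padicValRat ℓ ((-(N : ℚ)) - 0) = 0 := by rw [sub_zero, padicValRat.neg, hvN]
  have hv21 : padicValRat ℓ ((-(N : ℚ)) - N) = 0 := by
    rw [← neg_add', ← two_mul, padicValRat.neg, hv2N]
  have hXY₂ : Y ^ 2 = (X - N) * (X - 0) * (X - (-N)) := by rw [hXY]; ring
  have hXY₃ : Y ^ 2 = (X - (-N)) * (X - 0) * (X - N) := by rw [hXY]; ring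
  have e₁ : Even (padicValRat ℓ (X - 0)) :=
    Curve24A1.even_padicValRat_sub ℓ h01 h02 hv01 hv02 hY0 hXY
  have e₂ : Even (padicValRat ℓ (X - N)) :=
    Curve24A1.even_padicValRat_sub ℓ hN0' hNn hv10 hv12 hY0 hXY₂
  have e₃ : Even (padicValRat ℓ (X - (-N))) :=
    Curve24A1.even_padicValRat_sub ℓ hnN hnNN hv20 hv21 hY0 hXY₃
  refine ⟨?_, ?_, ?_⟩
  · rw [hu]
    simpa using key (e := 0) e₁ hx₁
  · rw [hu1]
    exact key e₂ hx₂
  · rw [hu2]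
    exact key e₃ hx₃

end Literature.NumberTheory.EllipticCurves.Monsky1990

end
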